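import Summits.BirchSwinnertonDyer.BirchSwinnertonDyer.Theorems.SignedLowerHalvesSmallImageLowerHalfBothSignsRttD2J1CyclotomicCarrier
import Literature.NumberTheory.EllipticCurves.IwasawaLayerModuleTwoVarLinear
import HarnessLib

/-!
# Route `SignedLowerHalves`, crux L `SmallImageLowerHalfBothSigns` (stmt-BirchSwinnertonDyer-23599), line `rtt_w3` v33 — stub S3α″ (`stub_junctionShaPi_ns`),
# brick α5′-4a: RIGIDITY OF THE PINS — the layer `H²((U_n)_P, X_k)` as a two-variable Iwasawa module for `(conj_γ − 1, 0)` and `proj n k (F • x) = F • proj n k x`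

INPUTS hand `bsd-inputs-honda-p1` g29 under LEAD `cruxlead-stmt-BirchSwinnertonDyer-23599` (cell `bsd-ssimc`); helper `--supports stmt-BirchSwinnertonDyer-23599`.
DEFINITIONS WITH BODIES (`toTwoVar`, `ofTwoVar`) + THEOREMS; no named fact, no instance, no `sorry`. Used by the Poitou–Tate socket (`…RttJunctionShaSocket`) to prove the
`Λ`-linearity of `π : Hom(U, ℚ/ℤ) → 𝐇²_{Iw,P}` WITHOUT the Kaplansky argument on the source (whose operator is not locally nilpotent): both level structures are pinned on the
TARGET layer, where `conj_γ − 1` is uniformly nilpotent and `p^k = 0`, by the tree's `IsLocNil₂.map_smul_of_commute` read in one variable (`T ↦ T₁`, `T₂ ↦ 0`).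
* `toTwoVar`/`ofTwoVar` (`Λ = ℤ_p⟦T⟧ ⇄ Λ₂ = ℤ_p⟦T₂⟧⟦T₁⟧`, `T ↦ T₁`, `T₂ ↦ 0`; `ofTwoVar_toTwoVar`, `ofTwoVar_X`, `ofTwoVar_C_X`, `ofTwoVar_C_C`);
* `isLocNil₂_cycLayer` (the layer `H²((U_n)_P, X_k)` for `(conj_γ − 1, 0)`), uniform bounds `cycLayerConjEndO_sub_one_pow_apply_eq_zero`, `zero_pow_apply_eq_zero`,
  `cycLayerConjEndO_apply_eq`, `cycLayerScalarO_padicInt` (`ℤ_p`-constants act through `ℤ/p^k`);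
* ★ `proj_smul_eq_selfModule_smul` — `proj n k (F • x) = toTwoVar F • proj n k x` for the `Λ`-structure `I.moduleIwasawa` of a pinned datum `I : CycIwasawaCohomologyDataO S κ γ θ′ P 2`,
  the right-hand side in the layer's canonical `selfModule` structure (pins (P5) `proj_X_smul`, (P7) `proj_C_smul`).
HONEST FRAMING: linear algebra; α5′, S3α″, crux L and BSD are NOT proved here and remain OPEN; BSD is proved for NO curve.
References: [Lang1990] Ch. 5 §1 (Thm. 1.1); [JohnsonLeungKings2011] §4.1 Def. 4.1, §4.2 Def. 4.2 (94) (arXiv p0012:L59–60, L109–112); [Rubin1991] §4 (p. 36).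
-/

set_option autoImplicit false
set_option linter.dupNamespace false -- D-0017: single-problem summit, the namespace repeats the problem name by design
noncomputable section

open scoped Classical
open NumberField IsDedekindDomain Field Function CategoryTheory PowerSeries

namespace Summit.BirchSwinnertonDyer.BirchSwinnertonDyer.Theorems.SmallImageRttJunctionSha

open Literature.NumberTheory.EllipticCurves Literature.NumberTheory.EllipticCurves.IwasawaDual Literature.NumberTheory.GaloisRepresentations
  Literature.NumberTheory.GaloisRepresentations.DiscreteGaloisModule Literature.NumberTheory.ComplexMultiplication.EllipticUnits.JohnsonLeungKings2011
  Literature.Algebra.Module.LocallyNilpotent Summit.BirchSwinnertonDyer.BirchSwinnertonDyer.Theorems.SmallImageRttD2J1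

/-! ## §1 One variable inside two; the layer as a `Λ₂`-module; rigidity of the pins -/

section TwoVar

variable (p : ℕ) [Fact p.Prime]

/-- `Λ = ℤ_p⟦T⟧ → Λ₂ = ℤ_p⟦T₂⟧⟦T₁⟧`, `T ↦ T₁` (coefficients to constants). [cite: Lang1990, Ch. 5 §1] -/
def toTwoVar : IwasawaAlgebra p →+* IwasawaAlgebra₂ p := PowerSeries.map PowerSeries.C

/-- `Λ₂ → Λ`, `T₁ ↦ T`, `T₂ ↦ 0` (constant coefficients of the coefficients). [cite: Lang1990, Ch. 5 §1] -/
def ofTwoVar : IwasawaAlgebra₂ p →+* IwasawaAlgebra p := PowerSeries.map PowerSeries.constantCoeff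

/-- `ofTwoVar ∘ toTwoVar = id`. [folklore] -/
theorem ofTwoVar_toTwoVar (F : IwasawaAlgebra p) : ofTwoVar p (toTwoVar p F) = F := by
  change ((PowerSeries.map PowerSeries.constantCoeff).comp (PowerSeries.map PowerSeries.C)) F = F
  rw [← PowerSeries.map_comp, PowerSeries.constantCoeff_comp_C]
  exact congrFun PowerSeries.map_id F

/-- `ofTwoVar T₁ = T`. [folklore] -/
theorem ofTwoVar_X : ofTwoVar p PowerSeries.X = PowerSeries.X := PowerSeries.map_X _

/-- `ofTwoVar T₂ = 0`. [folklore] -/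
theorem ofTwoVar_C_X : ofTwoVar p (PowerSeries.C PowerSeries.X) = 0 := by
  rw [ofTwoVar, PowerSeries.map_C, PowerSeries.constantCoeff_X, map_zero]

/-- `ofTwoVar (C (C c)) = C c`. [folklore] -/
theorem ofTwoVar_C_C (c : ℤ_[p]) : ofTwoVar p (PowerSeries.C (PowerSeries.C c)) = PowerSeries.C c := by
  rw [ofTwoVar, PowerSeries.map_C, PowerSeries.constantCoeff_C]

end TwoVar

section Layer

variable {K : Type} [Field K] [NumberField K] {p : ℕ} [Fact p.Prime] (S : Set (PadicAlgCl p)) (κ : ZpExtension K p) (γ : absoluteGaloisGroup K)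
  (θ' : absoluteGaloisGroup K →ₜ* (padicCoeffIntegers S)ˣ) (P : Set (HeightOneSpectrum (𝓞 K)))

/-- **The layer `H²((U_n)_P, X_k)` satisfies the two-variable local-nilpotence hypotheses for `(conj_γ − 1, 0)`** (`p^k`-torsion; unipotence of `conj_γ`).
[cite: Lang1990, Ch. 5 §1] [cite: JohnsonLeungKings2011, §4.2 (arXiv p0012:L109–112)] -/
theorem isLocNil₂_cycLayer (n k : ℕ) : IsLocNil₂ p (cycLayerConjEndO S κ θ' P n k 2 γ - 1) 0 :=
  { comm := Commute.zero_right _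
    torsion := fun s ↦ ⟨k, levelCohO_torsion S P θ' (κ.isOpen_layerSubgroup n) k 2 s⟩
    nil₁ := fun s ↦ exists_pow_cycLayerConjEndO_sub_one_apply_eq_zero S κ γ θ' P n k le_rfl s
    nil₂ := fun s ↦ ⟨1, by rw [pow_one, AddMonoid.End.zero_apply]⟩ }

/-- Uniform nilpotence: `(conj_γ − 1)^{k p^n + 1} = 0` on the layer `(n, k)`. [cite: Lang1990, Ch. 5 §1] -/
theorem cycLayerConjEndO_sub_one_pow_apply_eq_zero (n k : ℕ) (s : cycLayerCohO S κ θ' P n k 2) :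
    ((cycLayerConjEndO S κ θ' P n k 2 γ - 1) ^ (k * p ^ n + 1)) s = 0 :=
  pow_apply_eq_zero_of_le (Nat.le_succ _)
    (pow_mul_prime_pow_apply_eq_zero (Fact.out : p.Prime) _ n (cycLayerConjEndO_pow_apply_eq_self S κ γ θ' P n k le_rfl s)
      (levelCohO_torsion S P θ' (κ.isOpen_layerSubgroup n) k 2 s))

omit [NumberField K] in
/-- Unfolding `cycLayerConjEndO` to `cycLayerConjO`. [cite: JohnsonLeungKings2011, §4.2 (arXiv p0012:L109–112)] -/
theorem cycLayerConjEndO_apply_eq (n k i : ℕ) (v : cycLayerCohO S κ θ' P n k i) : cycLayerConjEndO S κ θ' P n k i γ v = cycLayerConjO S κ θ' P n k i γ v := rfl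

omit [NumberField K] in
/-- The second (zero) operator is uniformly nilpotent. [folklore] -/
theorem zero_pow_apply_eq_zero (n k : ℕ) (s : cycLayerCohO S κ θ' P n k 2) : ((0 : AddMonoid.End (cycLayerCohO S κ θ' P n k 2)) ^ (k * p ^ n + 1)) s = 0 := by
  rw [pow_succ, mul_zero, AddMonoid.End.zero_apply]

/-- **`ℤ_p`-constants act through `ℤ/p^k` on the layer**: `H²(c ⊗ id) = (c mod p^k) •` for `c ∈ ℤ_p` (the layer is `p^k`-torsion and `c ≡ (c mod p^k) (mod p^k ℤ_p)`).
[cite: Lang1990, Ch. 5 §1] -/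
theorem cycLayerScalarO_padicInt (n k i : ℕ) (c : ℤ_[p]) (y : cycLayerCohO S κ θ' P n k i) :
    cycLayerScalarO S κ θ' P n k i (padicIntToCoeffIntegers S c) y = (PadicInt.toZModPow k c).val • y := by
  letI := levelModuleO S P θ' (κ.layerSubgroup n) k i
  -- `c = (c mod p^k) + d p^k`
  have hmem : c - ((PadicInt.toZModPow k c).val : ℤ_[p]) ∈ RingHom.ker (PadicInt.toZModPow k) := by
    rw [RingHom.mem_ker, map_sub, map_natCast, ZMod.natCast_zmod_val, sub_self]
  rw [PadicInt.ker_toZModPow, Ideal.mem_span_singleton'] at hmem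
  obtain ⟨d, hd⟩ := hmem
  have hc : c = ((PadicInt.toZModPow k c).val : ℤ_[p]) + d * (p : ℤ_[p]) ^ k := by rw [hd]; abel
  have hpk : ((p : padicCoeffIntegers S) ^ k) • y = 0 := by
    rw [← Nat.cast_pow, Nat.cast_smul_eq_nsmul]
    exact levelCohO_torsion S P θ' (κ.isOpen_layerSubgroup n) k i y
  have key : (padicIntToCoeffIntegers S c) • y = ((PadicInt.toZModPow k c).val : padicCoeffIntegers S) • y := by
    conv_lhs => rw [hc]
    rw [map_add, map_natCast, add_smul, map_mul, map_pow, map_natCast, mul_smul, hpk, smul_zero, add_zero]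
  change cycLayerScalarO S κ θ' P n k i (padicIntToCoeffIntegers S c) y = _
  rw [cycLayerScalarO, ← levelModuleO_smul, key, Nat.cast_smul_eq_nsmul]

variable {S κ γ θ' P}

/-- ★ **RIGIDITY OF THE PINS for the `Λ`-structure `I.moduleIwasawa`**: `proj n k (F • x) = F • proj n k x` for EVERY `F ∈ Λ = ℤ_p⟦T⟧`, the right-hand side in the layer's canonical
two-variable structure for `(conj_γ − 1, 0)` at `toTwoVar F` (`IsLocNil₂.map_smul_of_commute`: source any `Λ₂`-module — here `I.H` along `ofTwoVar`; pins (P5) `proj_X_smul`, (P7)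
`proj_C_smul` + `cycLayerScalarO_padicInt`). [cite: Lang1990, Ch. 5 §1 (Thm. 1.1)] [cite: JohnsonLeungKings2011, §4.2 Def. 4.2 (94) (arXiv p0012:L109–112)] -/
theorem proj_smul_eq_selfModule_smul (I : CycIwasawaCohomologyDataO S κ γ θ' P 2) (n k : ℕ) (F : IwasawaAlgebra p) (x : I.H) :
    I.proj n k (letI := I.moduleIwasawa; F • x) = (letI := (isLocNil₂_cycLayer S κ γ θ' P n k).selfModule; toTwoVar p F • I.proj n k x) := by
  letI i2 : Module (IwasawaAlgebra₂ p) I.H := Module.compHom I.H ((iwasawaToIwasawaO S).comp (ofTwoVar p))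
  have hsm : ∀ (G : IwasawaAlgebra₂ p) (z : I.H), G • z = (iwasawaToIwasawaO S (ofTwoVar p G)) • z := fun _ _ ↦ rfl
  have key := (isLocNil₂_cycLayer S κ γ θ' P n k).map_smul_of_commute (M := I.H) (cycLayerConjEndO_sub_one_pow_apply_eq_zero S κ γ θ' P n k)
    (zero_pow_apply_eq_zero S κ θ' P n k) (fun s ↦ levelCohO_torsion S P θ' (κ.isOpen_layerSubgroup n) k 2 s) (I.proj n k)
    (fun z ↦ by
      rw [hsm, ofTwoVar_X, show iwasawaToIwasawaO S (PowerSeries.X : IwasawaAlgebra p) = PowerSeries.X from PowerSeries.map_X _, I.proj_X_smul]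
      rfl)
    (fun z ↦ by rw [hsm, ofTwoVar_C_X, map_zero, zero_smul, map_zero, AddMonoid.End.zero_apply])
    (fun c z ↦ by
      rw [hsm, ofTwoVar_C_C, show iwasawaToIwasawaO S (PowerSeries.C c : IwasawaAlgebra p) = PowerSeries.C (padicIntToCoeffIntegers S c) from PowerSeries.map_C _ c,
        I.proj_C_smul]
      exact cycLayerScalarO_padicInt S κ θ' P n k 2 c _)
    (toTwoVar p F) x
  rw [hsm, ofTwoVar_toTwoVar] at key
  exact key

end Layer

end Summit.BirchSwinnertonDyer.BirchSwinnertonDyer.Theorems.SmallImageRttJunctionSha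

end
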